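import Mathlib.Analysis.Complex.UpperHalfPlane.MoebiusAction
import Mathlib.GroupTheory.QuotientGroup.Basic
import Mathlib.GroupTheory.PresentedGroup
import Mathlib.GroupTheory.OrderOfElement
import Mathlib.LinearAlgebra.Matrix.SpecialLinearGroup
import Mathlib.Data.Fintype.Parity
import HarnessLib

/-!
# [J-III] §12.3–12.6 and §12.8 (group side): `S̃L₂(ℝ)`, `φ_∞`, log-links, geometric Θgau-links (typed)

Block E of the abc-iut cell (rung LADDER-ABC:A2.E), seat abc-iut-E-t35, slot T-35 (plan/E/ASSIGNMENTS.md §2, class P4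
«Geo»), file 1 of 2; node ids J3:Rmk12.3.2, J3:Def12.5.1, J3:Rmk12.5.3, J3:Def12.6.1, J3:Rmk12.6.2, J3:Rmk12.8.1,
J3:Lem12.8.2, J3:Def12.8.3, J3:Rmk12.8.4, J3:Thm12.8.5 (1) of plan/E/JOSHI-DAG.tsv (+ un-numbered (12.3.1), §12.4, §12.8
conventions); file 2 `Joshi/GeometricCase1Schottky.lean` = §12.4 `E_τ`, §12.7, Thm. 12.8.5 (2)–(4), Rmk. 12.8.6.
SOURCE: K. Joshi, *Construction of Arithmetic Teichmüller Spaces III*, arXiv:2401.13508**v4** (unrefereed, "Preliminary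
version for comments"; bib `Joshi2024ATS3`), §12 "Appendix III: The proof of geometric Szpiro inequality revisited",
PDF pp. 146–151. Locators «p.N l.a–b» = PDF page N, lines a–b of `HOME/lit/renders/Joshi-arxiv-2401.13508/pNNNN.txt`.

FRAMING (binding): this file TYPES a third party's unrefereed text so that block E can test Joshi's constructions against
the cell's residual `S = Summit.ABC.IUTFork.Cor312Vol.PilotKummerIndRelated`; it takes NO side on [IUTchIII] Cor. 3.12,
on Joshi's claims, or on Mochizuki's 2024 report on them; typed ≠ proved; typed AS A CANDIDATE ≠ endorsed; nothing here
bears on abc. §12 is Joshi's SETTLED-SETTING analogue (complex elliptic fibrations; [Amorós et al. 2000], [Zhang 2001],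
[Mochizuki 2016]) and §12.3–12.8 contain no disputed mathematics: every Lemma/Theorem of the slot with definite content is
PROVED over Mathlib (`UpperHalfPlane`, the `SL(2, R)`-action, `Complex.exp`), here Lem. 12.8.2, Thm. 12.8.5 (1),
Rmk. 12.6.2 and the quotient `Y_∞/φ_∞^ℤ ≃ X_∞` of Def. 12.5.1. The ONE external input, the universal cover `S̃L₂(ℝ)` with
its central extension (12.3.1) ([Zhang 2001, Lem. 3.5]), is the INTERFACE structure `CoverSL2R` whose fields quote
(12.3.1) (Mathlib has no universal covering group); Rmk. 12.3.2 (`S̃L₂(ℤ) ≅ B₃`, a classical result Joshi cites) is the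
`Prop` `CoverSL2R.BraidIso`, tagged, NOT asserted. OUR frozen `Cor312*`/`Thm311*` files are NOT imported (E-PLAN R14).
FAITHFULNESS FLAG (E-ref lane, not adjudicated): (F-b) Def. 12.8.3 "lying over a tuple of elliptic curves
`(E_{τ,1}, …, E_{τ,ℓ*})`" is typed as equality of POINTS of `ℍ = T₁` under `Y_∞ → X_∞ = SL₂(ℝ) → ℍ` (§12.4) — the
reading Thm. 12.8.5 (1) itself uses ("distinct points of the genus Teichmüller space `T₁ = ℍ`"); the weaker reading
"isomorphic curves" (`SL₂(ℤ)`-orbits) is not typed. Prose-only items (no mathematical assertion, recorded in docstrings):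
Rmk. 12.5.3 (1)–(5), Rmk. 12.8.1, Rmk. 12.8.4 (typed as the map `thetaCorrespondence`). §12.2 (the fibration `X → C`)
is not read by §12.3–12.8 (slot T-36, §12.11). DERIVED extras: `pi_z` (`z ↦ −1`), `logLinkChain_injective`; non-vacuity of Def. 12.8.3
(`CoverSL2R.thetaGauLink_nonempty`, over `τ = 2ℓ√−1`) is in file 2.
OUR-SIDE ANALOGUES (docstrings only; nothing bound — E-PLAN R4b/R14): chain of log-links `{g̃·φ_∞^n}` ↔ the `ℤ`-column
`Thm311.Column.frobΨ m`; Θgau-link `E_τ ↦ (E_{τ,j})_j` ↔ `Thm311.LinkData.horizontal`; labels `j = 1, …, ℓ*` ↔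
`Thm311.ThetaIndex.LabelStar`. No instance, notation, axiom or `sorry`; standard axioms only.
-/

noncomputable section

open Complex UpperHalfPlane
open scoped MatrixGroups UpperHalfPlane

namespace Summit.ABC.IUTFork.Joshi.ATS3.Geo

/-! ## §12.3 The universal cover `S̃L₂(ℝ)` as a central extension (J3:§12.3, (12.3.1)) -/

/-- **[J-III] §12.3, (12.3.1)** (p.146 l.26–32): "Let `SL₂(ℝ)` be the topological group of `2 × 2` matrices with real
entries and of determinant one. Let `S̃L₂(ℝ)` be the universal cover of `SL₂(ℝ)`. Then `S̃L₂(ℝ)` is described as a central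
extension ([Zhang, 2001, Lemma 3.5]) `1 → ⟨z²⟩ → S̃L₂(ℝ) → SL₂(ℝ) → 1` where `z ∈ S̃L₂(ℝ)` is a certain element, which
generates the center of `S̃L₂(ℝ)`". INTERFACE structure over an abstract group `Y` (= Joshi's `Y_∞`, Def. 12.5.1):
the fields are exactly (12.3.1) + "z generates the center" + "z has infinite order" (the centre of the universal cover is
infinite cyclic, `π₁(SL₂(ℝ)) ≅ ℤ` — implicit in "universal cover"). The topology and the universal property are NOT typed:
§12.3–12.8 read only these fields (Mathlib has no universal covering group). [claim: Joshi2024ATS3, status: disputed] -/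
structure CoverSL2R (Y : Type*) [Group Y] where
  /-- the covering projection `S̃L₂(ℝ) → SL₂(ℝ)` of (12.3.1). -/
  proj : Y →* SL(2, ℝ)
  /-- (12.3.1) is exact on the right: `S̃L₂(ℝ) → SL₂(ℝ) → 1`. -/
  proj_surjective : Function.Surjective proj
  /-- "`z ∈ S̃L₂(ℝ)` is a certain element" (p.146 l.31). -/
  z : Y
  /-- "which generates the center of `S̃L₂(ℝ)`" (p.146 l.31). -/
  center_eq : Subgroup.center Y = Subgroup.zpowers z
  /-- (12.3.1) is exact in the middle and on the left: the kernel of `S̃L₂(ℝ) → SL₂(ℝ)` is `⟨z²⟩`. -/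
  ker_eq : proj.ker = Subgroup.zpowers (z ^ 2)
  /-- `z` has infinite order (the centre `⟨z⟩` of the universal cover is infinite cyclic). -/
  not_isOfFinOrder_z : ¬IsOfFinOrder z

namespace CoverSL2R

variable {Y : Type*} [Group Y] (D : CoverSL2R Y)

/-- `S̃L₂(ℤ) ⊂ S̃L₂(ℝ)`: "the inverse image of `SL₂(ℤ) ⊂ SL₂(ℝ)`" (p.146 l.33 – p.147 l.1). -/
def coverSL2Z : Subgroup Y :=
  ((Matrix.SpecialLinearGroup.map (Int.castRingHom ℝ) : SL(2, ℤ) →* SL(2, ℝ)).range).comap D.proj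

/-- `S̃L₂(ℚ) ⊂ S̃L₂(ℝ)`: "the inverse image of `SL₂(ℚ) ⊂ SL₂(ℝ)`" (p.147 l.2–3). -/
def coverSL2Q : Subgroup Y :=
  ((Matrix.SpecialLinearGroup.map (Rat.castHom ℝ) : SL(2, ℚ) →* SL(2, ℝ)).range).comap D.proj

/-- Membership in `S̃L₂(ℚ)`: `g̃ ∈ S̃L₂(ℚ)` iff its image in `SL₂(ℝ)` comes from `SL₂(ℚ)` (definitional unfolding). -/
theorem mem_coverSL2Q_iff (g : Y) :
    g ∈ D.coverSL2Q ↔ ∃ h : SL(2, ℚ), Matrix.SpecialLinearGroup.map (Rat.castHom ℝ) h = D.proj g := by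
  simp [coverSL2Q]

/-- `z` is central (from `center_eq`). -/
theorem z_mem_center : D.z ∈ Subgroup.center Y := by
  rw [D.center_eq]; exact Subgroup.mem_zpowers D.z

/-- The relator `σ₁σ₂σ₁(σ₂σ₁σ₂)⁻¹` of Artin's braid group `B₃` on two generators `σ₁ ↦ 0`, `σ₂ ↦ 1`. [folklore] -/
def braidRelator : FreeGroup (Fin 2) :=
  FreeGroup.of 0 * FreeGroup.of 1 * FreeGroup.of 0 * (FreeGroup.of 1 * FreeGroup.of 0 * FreeGroup.of 1)⁻¹

/-- "the braid group on three letters" `B₃ = ⟨σ₁, σ₂ ∣ σ₁σ₂σ₁ = σ₂σ₁σ₂⟩` (Rmk. 12.3.2), as a presented group. Declared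
here for this file only (a `B₃` also occurs in an unrelated summit's Theorems file, which is not importable). [folklore] -/
abbrev BraidThree : Type := PresentedGroup ({braidRelator} : Set (FreeGroup (Fin 2)))

/-- **[J-III] Rmk. 12.3.2** (p.147 l.4–6): "by classical results or the explicit description in [Amorós et al., 2000]
or [Zhang, 2001], `S̃L₂(ℤ)` is isomorphic to the braid group on three letters (see [Rawnsley, 2012, Theorem 16])."
A classical result Joshi CITES (not his claim): typed as a `Prop` about the interface, NOT asserted, not a Literature
fact here; nothing in §12 uses it. [claim: Joshi2024ATS3, status: disputed] -/
@[claim "Joshi2024ATS3" "disputed"]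
def BraidIso : Prop := Nonempty (D.coverSL2Z ≃* BraidThree)

/-! ## §12.4 Classical Teichmüller space in genus one: `SL₂(ℝ) → ℍ` (J3:§12.4; `E_τ = ℂ/[1, τ]` is in file 2) -/

/-- **[J-III] §12.4** (p.147 l.7–14): "one has a natural mapping `SL₂(ℝ) → ℍ` given by `[a b; c d] ↦ (a·i + b)/(c·i + d)`"
— Mathlib's Möbius action applied to `i`. -/
def toUpperHalf (g : SL(2, ℝ)) : ℍ := g • UpperHalfPlane.I

/-- The printed formula `[a b; c d] ↦ (a·i + b)/(c·i + d)` (p.147 l.10–14). -/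
theorem coe_toUpperHalf (g : SL(2, ℝ)) :
    (toUpperHalf g : ℂ) = ((g 0 0 : ℂ) * Complex.I + g 0 1) / ((g 1 0 : ℂ) * Complex.I + g 1 1) := by
  simp [toUpperHalf, coe_specialLinearGroup_apply, coe_I]

/-- The composite `Y_∞ = S̃L₂(ℝ) → X_∞ = SL₂(ℝ) → ℍ` (§12.4 with (12.3.1)): the point of `ℍ` a lift `g̃` "lies over"
(Def. 12.6.1 "a lift of `τ ∈ ℍ` to `S̃L₂(ℝ)`", Def. 12.8.3 "lying over"). -/
def toH (g : Y) : ℍ := toUpperHalf (D.proj g)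

end CoverSL2R

/-! ## §12.5 Global (geometric) Fargues–Fontaine curves `Y_∞`, `X_∞` and the global Frobenius `φ_∞` (J3:Def12.5.1, Rmk12.5.3) -/

namespace CoverSL2R

variable {Y : Type*} [Group Y] (D : CoverSL2R Y)

/-- **[J-III] Def. 12.5.1, (12.5.2)** (p.147 l.24–34): "Let `Y_∞ = S̃L₂(ℝ)` and `X_∞ = SL₂(ℝ)`. I will refer to `Y_∞` as
the incomplete global Fargues-Fontaine curve and `X_∞ = SL₂(ℝ)` as the complete global Fargues-Fontaine curve. I will
write `φ_∞ = z² ∈ S̃L₂(ℝ)` for the generator of the central extension (12.3.1) and refer to `φ_∞` as the global Frobenius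
morphism of `Y_∞`." Here `Y_∞` = the carrier `Y`, `X_∞` = `SL(2, ℝ)`, and this is `φ_∞`. Rmk. 12.5.3 (1)–(5) (p.147 l.35 –
p.148 l.15: `Y_∞ ↔ 𝒴_L`, `X_∞ ↔ 𝒴_L/φ^ℤ`, local `Y_{F,E}/φ^ℤ ≃ X_{F,E}`, `[𝒴_L/L*]`, [Joshi, 2023a, Thm. 4.2.3 / Cor. 4.2.5])
are ANALOGIES — recorded, not typed. Our-side analogue (not bound): the log-link direction `m ↦ Thm311.Column.frobΨ m`. -/
def phi : Y := D.z ^ 2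

/-- `φ_∞` is central. -/
theorem phi_mem_center : D.phi ∈ Subgroup.center Y := Subgroup.pow_mem _ D.z_mem_center 2

/-- (12.3.1) restated: the kernel of `Y_∞ → X_∞` is `φ_∞^ℤ`. -/
theorem ker_eq_zpowers_phi : D.proj.ker = Subgroup.zpowers D.phi := D.ker_eq

/-- `φ_∞` dies in `X_∞`. -/
theorem pi_phi : D.proj D.phi = 1 := by
  rw [← MonoidHom.mem_ker, ker_eq_zpowers_phi]; exact Subgroup.mem_zpowers _

/-- Every power of `φ_∞` dies in `X_∞`. -/
theorem pi_phi_zpow (n : ℤ) : D.proj (D.phi ^ n) = 1 := by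
  rw [map_zpow, pi_phi, one_zpow]

/-- `φ_∞` has infinite order (from `not_isOfFinOrder_z`). -/
theorem not_isOfFinOrder_phi : ¬IsOfFinOrder D.phi := fun h =>
  D.not_isOfFinOrder_z ((isOfFinOrder_pow.mp h).resolve_right two_ne_zero)

/-- DERIVED sanity check on the interface: `z ↦ −1 ∈ SL₂(ℝ)` (centre `{±1}`; `z ∉ ker = ⟨z²⟩` as `z` has infinite order).
Not stated in print ("described explicitly in [Zhang, 2001] and so I will not recall that description here", p.146 l.31–32). -/
theorem pi_z : D.proj D.z = -1 := by
  have hc : D.proj D.z ∈ Subgroup.center SL(2, ℝ) := by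
    refine Subgroup.mem_center_iff.mpr fun B => ?_
    obtain ⟨g, rfl⟩ := D.proj_surjective B
    rw [← map_mul, ← map_mul, Subgroup.mem_center_iff.mp D.z_mem_center g]
  obtain ⟨r, hr, hrz⟩ := Matrix.SpecialLinearGroup.mem_center_iff.mp hc
  have hr2 : r ^ 2 = 1 := by simpa using hr
  rcases sq_eq_one_iff.mp hr2 with rfl | rfl
  · exfalso
    have h1 : D.z ∈ D.proj.ker := by
      rw [MonoidHom.mem_ker]
      exact Subtype.ext (by rw [Matrix.SpecialLinearGroup.coe_one, ← hrz, map_one])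
    rw [D.ker_eq, Subgroup.mem_zpowers_iff] at h1
    obtain ⟨k, hk⟩ := h1
    refine D.not_isOfFinOrder_z (isOfFinOrder_iff_zpow_eq_one.mpr ⟨2 * k - 1, by omega, ?_⟩)
    rw [zpow_sub_one, zpow_mul, zpow_ofNat, hk, mul_inv_cancel]
  · exact Subtype.ext (by
      rw [Matrix.SpecialLinearGroup.coe_neg, Matrix.SpecialLinearGroup.coe_one, ← hrz, map_neg, map_one])

/-- **Def. 12.5.1, last sentence** (p.147 l.29–34): "because of (12.3.1), one has `Y_∞/φ_∞^ℤ ≃ X_∞` is a quotient by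
the global Frobenius morphism" — DERIVED: `Y_∞` modulo the kernel `φ_∞^ℤ` (`ker_eq_zpowers_phi`) is `X_∞ = SL₂(ℝ)`. -/
def quotientKerEquiv : Y ⧸ D.proj.ker ≃* SL(2, ℝ) :=
  QuotientGroup.quotientKerEquivOfSurjective D.proj D.proj_surjective

/-! ## §12.6 Existence of log-links (J3:Def12.6.1, Rmk12.6.2) -/

/-- **[J-III] Def. 12.6.1** (p.148 l.19–24): "Let `g̃_{τ,0} ∈ S̃L₂(ℝ)` be a lift of `τ ∈ ℍ` to `S̃L₂(ℝ)`. If `g̃′_{τ,0}` is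
another lift of `τ` then I will say that `g̃_{τ,0}` and `g̃′_{τ,0}` are log-linked if `g̃′_{τ,0} = g̃_{τ,0} · φ_∞`."
(Typed for arbitrary `g̃, g̃′ ∈ Y_∞`; log-linked elements lie over the same `τ`, `toH_logLinkChain`.) Our-side analogue
(not bound): Mochizuki's log-link between vertically adjacent `Θ^{±ell}NF`-Hodge theaters, `Thm311.LinkData`.
[claim: Joshi2024ATS3, status: disputed] -/
@[claim "Joshi2024ATS3" "disputed"]
def IsLogLinked (g g' : Y) : Prop := g' = g * D.phi

/-- **[J-III] Def. 12.6.1, second half** (p.148 l.25–28): "I will call `{g̃_{τ,n} = g̃_{τ,0} · φ_∞^n : n ∈ ℤ}` a chain of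
log-links." — the chain through `g̃ = g̃_{τ,0}` as a `ℤ`-indexed family. -/
def logLinkChain (g : Y) (n : ℤ) : Y := g * D.phi ^ n

/-- Consecutive members of a chain are log-linked: `g̃_{τ,n+1} = g̃_{τ,n} · φ_∞`. -/
theorem isLogLinked_logLinkChain (g : Y) (n : ℤ) :
    D.IsLogLinked (D.logLinkChain g n) (D.logLinkChain g (n + 1)) := by
  rw [IsLogLinked, logLinkChain, logLinkChain, zpow_add_one, mul_assoc]

/-- DERIVED: a chain of log-links is infinite — `n ↦ g̃_{τ,n}` is injective (`φ_∞` has infinite order). -/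
theorem logLinkChain_injective (g : Y) : Function.Injective (D.logLinkChain g) := fun _ _ h =>
  injective_zpow_iff_not_isOfFinOrder.mpr D.not_isOfFinOrder_phi (mul_left_cancel h)

/-- All members of a chain lie over the same point of `X_∞` … -/
theorem pi_logLinkChain (g : Y) (n : ℤ) : D.proj (D.logLinkChain g n) = D.proj g := by
  rw [logLinkChain, map_mul, pi_phi_zpow, mul_one]

/-- … hence over the same `τ ∈ ℍ`. -/
theorem toH_logLinkChain (g : Y) (n : ℤ) : D.toH (D.logLinkChain g n) = D.toH g := by
  rw [toH, toH, pi_logLinkChain]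

/-- **[J-III] Rmk. 12.6.2** (p.148 l.29–30): "Note that a chain of log-links is the fiber over `Y_∞ → X_∞` over the common
image of `g̃_{τ,n}` in `X_∞ = SL₂(ℝ)`." PROVED over the interface (exactness of (12.3.1)). -/
theorem range_logLinkChain (g : Y) : Set.range (D.logLinkChain g) = D.proj ⁻¹' {D.proj g} := by
  ext y
  simp only [Set.mem_range, Set.mem_preimage, Set.mem_singleton_iff]
  constructor
  · rintro ⟨n, rfl⟩; exact D.pi_logLinkChain g n
  · intro hy
    have hk : g⁻¹ * y ∈ D.proj.ker := by rw [MonoidHom.mem_ker, map_mul, map_inv, hy, inv_mul_cancel]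
    rw [ker_eq_zpowers_phi, Subgroup.mem_zpowers_iff] at hk
    obtain ⟨n, hn⟩ := hk
    exact ⟨n, by rw [logLinkChain, hn, mul_inv_cancel_left]⟩

end CoverSL2R

/-! ## §12.8 Existence of Θgau-links, group side (J3:§12.8 conventions, Rmk12.8.1, Lem12.8.2, Def12.8.3, Rmk12.8.4, Thm12.8.5 (1)) -/

/-- Scaling a point of `ℍ` by a positive real `a` (`τ ↦ a·τ`; Lem. 12.7.1/12.7.3 `α·τ`, §12.8 `j²·τ`, `j²τ/2ℓ`). -/
def scale (a : ℝ) (ha : 0 < a) (τ : ℍ) : ℍ := (⟨a, ha⟩ : {x : ℝ // 0 < x}) • τ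

/-- `↑(a·τ) = a * τ` in `ℂ`. -/
@[simp] theorem coe_scale (a : ℝ) (ha : 0 < a) (τ : ℍ) : (scale a ha τ : ℂ) = (a : ℂ) * τ := by
  simp [scale, Complex.real_smul]

/-- `scale` depends on `a` only (proof-irrelevant congruence). -/
theorem scale_congr {a b : ℝ} (ha : 0 < a) (hb : 0 < b) (h : a = b) (τ : ℍ) : scale a ha τ = scale b hb τ := by
  subst h; rfl

/-- `a·(b·τ) = (ab)·τ`. -/
theorem scale_scale (a b : ℝ) (ha : 0 < a) (hb : 0 < b) (τ : ℍ) :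
    scale a ha (scale b hb τ) = scale (a * b) (mul_pos ha hb) τ := by
  ext1; simp [mul_assoc]

/-- `τ ↦ a·τ` is injective in `a` (for fixed `τ`, since `τ ≠ 0`). -/
theorem scale_left_injective (τ : ℍ) {a b : ℝ} (ha : 0 < a) (hb : 0 < b) (h : scale a ha τ = scale b hb τ) :
    a = b := by
  have := UpperHalfPlane.pos_real_smul_injective τ (a₁ := ⟨a, ha⟩) (a₂ := ⟨b, hb⟩) h
  exact congrArg Subtype.val this

/-- **[J-III] §12.8** (p.149 l.32–33): "Let `ℓ ≥ 5` be a prime number, let `ℓ* = (ℓ − 1)/2`." Our-side analogue (not bound):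
`Thm311.ThetaIndex.lstar`. -/
structure Level where
  /-- the prime `ℓ`. -/
  ell : ℕ
  /-- "`ℓ` … a prime number". -/
  prime : ell.Prime
  /-- "`ℓ ≥ 5`". -/
  five_le : 5 ≤ ell

namespace Level

variable (L : Level)

/-- `ℓ* = (ℓ − 1)/2` (p.149 l.33). -/
def lstar : ℕ := (L.ell - 1) / 2

/-- `ℓ > 0`. -/
theorem ell_pos : 0 < L.ell := lt_of_lt_of_le (by norm_num) L.five_le

/-- `(ℓ : ℝ) > 0`. -/
theorem ell_pos_real : (0 : ℝ) < L.ell := Nat.cast_pos.mpr L.ell_pos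

/-- The labels `j = 1, 2, …, ℓ*` (p.149 l.34), as `Fin ℓ*` with `j ↦ j.val + 1`. Our-side analogue (not bound):
`Thm311.ThetaIndex.LabelStar`. -/
abbrev Label : Type := Fin L.lstar

/-- the integer `j ≥ 1` of a label. -/
def jOf (j : L.Label) : ℕ := j.val + 1

/-- `j ≥ 1`, as a positive real. -/
theorem jOf_pos (j : L.Label) : (0 : ℝ) < L.jOf j := Nat.cast_pos.mpr (Nat.succ_pos _)

/-- `j² > 0`. -/
theorem jOf_sq_pos (j : L.Label) : (0 : ℝ) < (L.jOf j : ℝ) ^ 2 := pow_pos (L.jOf_pos j) 2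

/-- `1/2ℓ > 0`. -/
theorem inv_two_ell_pos : (0 : ℝ) < 1 / (2 * L.ell) := by
  have := L.ell_pos_real; positivity

/-- `j²/2ℓ > 0`. -/
theorem jOf_sq_div_pos (j : L.Label) : (0 : ℝ) < (L.jOf j : ℝ) ^ 2 / (2 * L.ell) :=
  div_pos (L.jOf_sq_pos j) (by have := L.ell_pos_real; positivity)

/-- `j ↦ j` is injective on labels. -/
theorem jOf_injective : Function.Injective L.jOf := fun _ _ h => Fin.ext (Nat.succ_injective h)

end Level

/-- **[J-III] §12.8 / Lem. 12.8.2** (p.149 l.41–46, p.150 l.9–16): the matrix `α_j = (j 0; 0 1/j) ∈ SL₂(ℚ)`, `j ≥ 1`.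
Rmk. 12.8.1 (p.150 l.1–8), recorded: "The reason I want to consider `SL₂(ℚ)` in place of `GL₂⁺(ℚ)` is that
`SL₂(ℚ) ⊂ SL₂(ℝ)`. Working with `GL₂⁺(ℚ)` would require replacing `SL₂(ℝ)` by `GL₂⁺(ℝ)` in [Zhang, 2001],
[Amorós et al., 2000] – this can be done, but presently I have not written down all the changes this necessitates". -/
def alpha (j : ℕ) (hj : j ≠ 0) : SL(2, ℚ) :=
  ⟨!![(j : ℚ), 0; 0, (j : ℚ)⁻¹], by simp [Matrix.det_fin_two_of, hj]⟩

/-- **[J-III] Lem. 12.8.2, one factor** (p.149 l.47–58; p.150 l.17–24): `α_j` "operates on `ℍ` by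
`τ ↦ (j·τ)/(j^{−1}) = j²·τ`" — PROVED for Mathlib's Möbius action of `SL₂(ℚ) ⊂ SL₂(ℝ)` on `ℍ`. -/
theorem alpha_smul (j : ℕ) (hj : j ≠ 0) (τ : ℍ) :
    alpha j hj • τ = scale ((j : ℝ) ^ 2) (by positivity) τ := by
  ext1
  rw [coe_specialLinearGroup_apply, coe_scale]
  have hj' : (j : ℂ) ≠ 0 := by exact_mod_cast hj
  simp [alpha]
  field_simp

/-- **[J-III] Lem. 12.8.2** (p.150 l.9–24): "the `ℓ*`-tuple `(α_1, …, α_{ℓ*}) ∈ SL₂(ℚ)^{ℓ*}` operates on `ℍ^{ℓ*}`, by the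
usual Möbius action on each of the factors, and under this action the diagonal tuple `(τ, τ, …, τ) ∈ ℍ^{ℓ*}` is mapped to
`(1²·τ, 2²·τ, …, ℓ*²·τ)`. Proof. This is completely clear." PROVED. -/
theorem alpha_smul_diagonal (L : Level) (τ : ℍ) :
    (fun j : L.Label => alpha (L.jOf j) (Nat.succ_ne_zero _) • τ) =
      fun j => scale ((L.jOf j : ℝ) ^ 2) (L.jOf_sq_pos j) τ :=
  funext fun _ => alpha_smul _ _ τ

/-- **[J-III] Rmk. 12.8.4** (p.150 l.33–37): "One may think of `E_τ ↦ (E_{τ,1}, E_{τ,2}, …, E_{τ,ℓ*})` as a correspondence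
i.e. a one-to-many function on the moduli of elliptic curves arising from the correspondence on `ℍ` given by
`τ ↦ (1²·τ, 2²·τ, …, ℓ*²·τ) ∈ ℍ^{ℓ*}`." — that map. -/
def thetaCorrespondence (L : Level) (τ : ℍ) : L.Label → ℍ :=
  fun j => scale ((L.jOf j : ℝ) ^ 2) (L.jOf_sq_pos j) τ

/-- **[J-III] §12.8 convention** (p.149 l.34–40): "I will write `E_{τ,j} = E_{τ/2ℓ, j²}`. Note that the lattice
`[1, τ·j²/2ℓ]` for `E_{τ,j}` can be obtained from the lattice `[1, τ/2ℓ]` of `E_{τ,1}` by using the matrix `α_j`" — the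
point `j²τ/2ℓ ∈ ℍ` of `E_{τ,j}` (`j = 1, …, ℓ*`). -/
def tauPt (L : Level) (τ : ℍ) (j : L.Label) : ℍ :=
  scale ((L.jOf j : ℝ) ^ 2 / (2 * L.ell)) (L.jOf_sq_div_pos j) τ

/-- `E_{τ,j}`'s point is the correspondence of Rmk. 12.8.4 applied to `τ/2ℓ` ("`E_{τ,j} = E_{τ/2ℓ, j²}`"). -/
theorem tauPt_eq_thetaCorrespondence (L : Level) (τ : ℍ) (j : L.Label) :
    tauPt L τ j = thetaCorrespondence L (scale (1 / (2 * L.ell)) L.inv_two_ell_pos τ) j := by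
  simp only [tauPt, thetaCorrespondence, scale_scale]
  exact scale_congr _ _ (by ring) τ

namespace CoverSL2R

variable {Y : Type*} [Group Y] (D : CoverSL2R Y)

/-- **[J-III] Def. 12.8.3** (p.150 l.25–32): "Let `ℓ ≥ 5` be a prime number. A Θgau-link is an `ℓ*`-tuple
`(g̃_1, …, g̃_{ℓ*}) ∈ S̃L₂(ℚ)^{ℓ*} ⊂ Y_∞^{ℓ*}` lying over a tuple of elliptic curves `(E_{τ,1}, E_{τ,2}, …, E_{τ,ℓ*})` for some
`τ ∈ ℍ` (with `E_{τ,j}` given by the above convention and `j = 1, 2, …, ℓ*`). The "link" here is the rule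
`E_τ ↦ (E_{τ,1}, E_{τ,2}, …, E_{τ,ℓ*})`." Flag (F-b): "lying over" typed as `toH (g̃_j) = j²τ/2ℓ ∈ ℍ = T₁` (the reading
Thm. 12.8.5 (1) uses). Our-side analogue (not bound): `Thm311.LinkData.horizontal`; arithmetic counterpart [J-III] §4.2.3. -/
structure ThetaGauLink (L : Level) where
  /-- "for some `τ ∈ ℍ`". -/
  τ : ℍ
  /-- the `ℓ*`-tuple `(g̃_1, …, g̃_{ℓ*})` in `Y_∞`. -/
  g : L.Label → Y
  /-- "`∈ S̃L₂(ℚ)^{ℓ*}`". -/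
  mem : ∀ j, g j ∈ D.coverSL2Q
  /-- "lying over `(E_{τ,1}, …, E_{τ,ℓ*})`": `g̃_j ↦ j²τ/2ℓ ∈ ℍ` under `Y_∞ → X_∞ → ℍ`. -/
  over : ∀ j, D.toH (g j) = tauPt L τ j

end CoverSL2R

/-- **[J-III] Thm. 12.8.5 (1)** (p.150 l.41–42): "The elliptic curves `E_{τ,1}, E_{τ,2}, …, E_{τ,ℓ*}` correspond to distinct
points of the genus Teichmüller space `T₁ = ℍ`." PROVED: `j ↦ j²τ/2ℓ` is injective on `j = 1, …, ℓ*`. -/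
theorem tauPt_injective (L : Level) (τ : ℍ) : Function.Injective (tauPt L τ) := by
  intro j k h
  have h1 := scale_left_injective τ _ _ h
  have hℓ : (2 * L.ell : ℝ) ≠ 0 := by have := L.ell_pos_real; positivity
  have h2 : (L.jOf j : ℝ) ^ 2 = (L.jOf k : ℝ) ^ 2 := (div_left_inj' hℓ).mp h1
  have h3 : (L.jOf j : ℝ) = L.jOf k := (pow_left_inj₀ (L.jOf_pos j).le (L.jOf_pos k).le two_ne_zero).mp h2
  exact L.jOf_injective (by exact_mod_cast h3)

/-- Thm. 12.8.5 (1) for a Θgau-link: the points its members lie over are pairwise distinct. -/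
theorem CoverSL2R.ThetaGauLink.toH_injective {Y : Type*} [Group Y] {D : CoverSL2R Y} {L : Level}
    (Λ : D.ThetaGauLink L) : Function.Injective fun j => D.toH (Λ.g j) := by
  intro j k h
  exact tauPt_injective L Λ.τ (by simpa only [Λ.over] using h)

/-- `ℓ* ≥ 2` (from "`ℓ ≥ 5`", p.149 l.32–33): the field `two_le_lstar` slot T-36's `GeoLocus.HeightDatum` reads. (Appended in a
comment-level re-land that also re-enqueues the module build; no earlier declaration changed.) -/
theorem Level.two_le_lstar (L : Level) : 2 ≤ L.lstar := by
  have := L.five_le; unfold Level.lstar; omega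

end Summit.ABC.IUTFork.Joshi.ATS3.Geo

end
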